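import Literature.MathematicalPhysics.QuantumFieldTheory.Balaban1983to89.B8Thm2TorusOfProp6DeltaAFour

/-!
# `Balaban1983to89.B8Thm2TorusCoverOfProp6DeltaAFour` — sub-row G-B8-T2S, file G8: [Balaban1985RegularSpaces] THEOREM 2 AT THE COVER TORUS OF EVERY MEMBER
# `(F, n, K)` OF THE UV3 FAMILY — NO LOCATED VOLUME THRESHOLD ON THE MEMBER (the cover exponent `k₀` is chosen here; the consumer's period reduction
# `thm2TorusAt_of_dvd` brings Thm 2 back to the member's own torus)

statement-level skeleton of published theorems with citation tags; proofs where landed; nothing here is a claim about the Yang–Mills mass gap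

T. Bałaban, *Spaces of regular gauge field configurations on a lattice and gauge fixing conditions*, Commun. Math. Phys. **99** (1985) 75–102
[`Balaban1985RegularSpaces`, "[B8]"]: Thm 2 p. 83, (1.29) p. 81, (1.33)–(1.39) pp. 82–83, p. 77 («T_η ⊂ ηZ^d … periodic»), Prop. 3 (1.58)–(1.60) pp. 86–87.
T. Bałaban, *Propagators for lattice gauge theories in a background field*, CMP **99** (1985) 389–434 [`Balaban1985BackgroundPropagators`]: (3.35)–(3.37) p. 396,
Thm 3.3 p. 399, (3.69) p. 404, p. 408 l. 30–34, Thm 3.11 p. 416.  [`Balaban1985UV3`] (1)–(3) p. 256 (the family of tori `T^{(K)}`, volume `L^m`).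

WHY.  G6b §3 `hThm2_of_prop6_deltaAFour` serves the 19200 dictionary's binder only for the members `(F, n, K)` with `k₀ ≤ F.m + n` (the located volume
threshold: the catalogue's members need `k + k₀ ≤ m + K`), whereas `Prop7SPrintThm2Dict.prop2Printed_sPrint_of_thm2SetupSUAt` quantifies ALL `(F, n, K) ∈ Idx L`
(LF-2VOL, ym3-torus-plan g27, HOME∕INBOX l.14796).  pub-ymgap's period reduction `BalabanUVNodesN16Thm2TorusOfCover.thm2TorusAt_of_dvd`
(`Thm2TorusAt L k P′ … → P ∣ P′ → L^k ∣ P → 16·B₁·c₁ ≤ 1 → Thm2TorusAt L k P …`, both halves of Thm 2 used) serves the small members from a COVER torus.  THIS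
FILE hands it exactly what it needs, for EVERY member: Thm 2 (both halves, `Thm2TorusAt`, G6b §2′) at the cover torus `PV 2 ℓ (F.m + k₀) K` — same `k = K − n`,
same `η = L^{−(K−n)}`, same `(B₁, c₁)` (bound before `F`) — together with the two divisibilities `P ∣ P′ = L^{k₀}·P` and `L^{K−n} ∣ P` (`P = 2L^{F.m+K}`); the
(Δa) members are asked at the COVER torus' shape-members.

WHAT IS PROVED (kernel; 0 `def`, 0 `… : Prop` fact, 0 sorry; standard axioms).  ★★★★★ `hThm2Cover_of_prop6_deltaAFour` — inputs as G6b §3 (`d + 1 = 3`,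
`N = 2`, the consumer's big-block exponent `a′` with `L^{a′} ≥ 8`): `∃ a₀′ > 0, ∃ k₀, ∃ c_α > 0, ∀ c_L …, ∃ B₁ B₂ c₁ > 0, ∀ F : T3Family, F.L = ℓ + 1 → ∀ n < K`,
(Δa) [the FOUR Δ_a-side members at the shape-members of the cover torus `PV 2 ℓ (F.m + k₀) K`, levels `1 ≤ m′ ≤ K − n`, `i.Mh = L^{a′}`] →
`P ∣ P′ ∧ L^{K−n} ∣ P ∧ Thm2TorusAt (ℓ+1) (K − n) P′ (eta F n K) 0 B₁ B₂ c₁ len SU(2) ⊤`, `P = ((F.P K).sitesPerDir 0)`, `P′ = ((PV 2 ℓ (F.m + k₀) K).sitesPerDir 0)`.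

HONEST SCOPE ∕ NOT CLAIMED.  Composition BY NAME (G6b §2′ at `m := F.m + k₀`, A13's `P_eq_PV`, `B8Thm2SetupTorus.pow_dvd_period`) plus two divisibilities; the
period reduction itself is the consumer's (`thm2TorusAt_of_dvd` lives under `Summits/`, not importable here) with its side condition `16·B₁·c₁ ≤ 1`
(`Thm2TorusAt.anti_c₁`).  (Δa) displayed (at the cover torus), inhabited by nothing here; `SU(2)`, `d + 1 = 3`; sup-entries only (`β₀ = 0`); count-neutral; no
summit ∕ sub-problem statement is proved; NOT a node discharge; `stub_PV3A` NOT discharged; nothing continuum ∕ ℝ⁴ ∕ OS ∕ mass-gap ∕ Clay — the Yang–Mills mass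
gap is NOT proved by any of this.  No `sorry`, no `axiom`, no `def`, no `instance`, no `notation`.  NEW file; nothing landed is modified.  Cell `lit-balaban`, seat
`lit-balaban-t2s-1` gen 9, 2026-08-28; `--supports stmt-QuantumFields-19200`.
-/

noncomputable section

open scoped BigOperators

namespace Literature.MathematicalPhysics.QuantumFieldTheory.Balaban1983to89.B8Thm2TorusCoverOfProp6DeltaAFour

open Node00 B6KLevelCensusIndexV1
open B7Prop1Explicit renaming Site → LSite
open B7Prop2Explicit (unitaryUnits C0 c2')
open B6GlobalChartV1 (PV)
open B9GeoNormsKLevelV1 (geo9K)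
open B8Ineq132 (InAk)
open B8Thm2TorusLettersPerOfKnit (bgY)
open B9B8AveragingJunction (parKnitY)
open B9Eq316AveragingTransposeZd (betaTau alphaQ)
open B7Prop2SpecialUnitary (specialUnitaryUnits)
open B8Thm2TorusAt (Thm2TorusAt)
open B8Thm2SetupTorus (pow_dvd_period)
open B8Thm2TorusOfProp6DeltaAFour (thm2TorusAtSU_ofProp6_deltaAFour_exists)
open B8Thm2T3FamilyBinder (P_eq_PV)
open T3ContinuumYM3Torus (T3Family)
open T3SectALandauChart (eta eta_pos)
open T4TermwiseTorus (IsPeriodic)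
open scoped Matrix Matrix.Norms.L2Operator

variable {ℓ : ℕ} {hL : Odd (ℓ + 1) ∧ 1 < ℓ + 1} {hd₃ : 1 ≤ 2 + 1}
variable [instF : ∀ i : KIdx 2 ℓ hd₃ hL 1 1, Fintype (geo9K i).Site] [instD : ∀ i : KIdx 2 ℓ hd₃ hL 1 1, DecidableEq (geo9K i).Site]

/-- ★★★★★ **[B8] THM 2 (BOTH HALVES) AT THE COVER TORUS OF EVERY MEMBER `(F, n, K)`, WITH THE TWO DIVISIBILITIES THE PERIOD REDUCTION READS** — no located volume
threshold on the member: the cover exponent `k₀` is this file's.  `∃ a₀′ > 0, ∃ k₀, ∃ c_α > 0, ∀ c_L …, ∃ B₁ B₂ c₁ > 0, ∀ F : T3Family, F.L = ℓ + 1 → ∀ n < K`,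
(Δa at the cover torus `PV 2 ℓ (F.m + k₀) K`) → `P ∣ P′ ∧ L^{K−n} ∣ P ∧ Thm2TorusAt (ℓ+1) (K − n) P′ (eta F n K) 0 B₁ B₂ c₁ len SU(2) ⊤`.  HONEST SCOPE: (Δa)
displayed; the reduction `P′ ↦ P` is the consumer's `thm2TorusAt_of_dvd`; `stub_PV3A` NOT discharged; the Yang–Mills mass gap is NOT proved.
[cite: Balaban1985RegularSpaces, Thm 2 p.83, (1.29) p.81, (1.33)–(1.39) pp.82–83, p.77, (1.58)–(1.60) pp.86–87; Balaban1985BackgroundPropagators, p.408 l.30–34, (3.35)–(3.37) p.396, Thm 3.3 p.399, (3.69) p.404, Thm 3.11 p.416; Balaban1985UV3, (1)–(3) p.256] -/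
theorem hThm2Cover_of_prop6_deltaAFour (hℓ : 4 ≤ ℓ)
    (τ : Matrix (Fin 2) (Fin 2) ℂ →ₗ[ℂ] ℂ) (hτ : ∀ a, τ a = Matrix.trace a) (hτt : ∀ a b, τ (a * b) = τ (b * a))
    {Cτ : ℝ} (hCτ : ∀ x y : Matrix (Fin 2) (Fin 2) ℂ, |(τ (star x * y)).re| ≤ Cτ * ‖x‖ * ‖y‖)
    {M : ℝ} (hM1 : 1 ≤ M) {B₀ aT : ℝ} (hB₀ : 0 < B₀) (haT : 0 < aT) (haTQ : aT ≤ alphaQ (2 + 1) (ℓ + 1) / ((ℓ + 1 : ℕ) : ℝ) ^ 2)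
    (haT3 : C0 (2 + 1) * aT ≤ 1 / 3) (haT2 : 2 * aT ≤ c2' (2 + 1) (ℓ + 1))
    (hεB : 2 * ((48 * (((2 : ℕ) : ℝ) + 1) + 14 * ((2 : ℕ) : ℝ) * M + (32 * (((2 : ℕ) : ℝ) + 2) ^ 2 +
        12 * (((2 : ℕ) : ℝ) + 1) ^ 2 * (13344 * (((2 : ℕ) : ℝ) + 1) * (((2 : ℕ) : ℝ) + 2) ^ 2 * (((2 : ℕ) : ℝ) + 5) * (((ℓ + 1 : ℕ) : ℝ)) ^ (2 + 4)) *
          (Cτ * (letI : CStarAlgebra (Matrix (Fin 2) (Fin 2) ℂ) := {}; betaTau τ)))) * aT) * B₀ ≤ 1)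
    {len : LSite (2 + 1) → ℝ}
    {ι : Type} [Fintype ι] [DecidableEq ι] (b : Module.Basis ι ℝ (Matrix (Fin 2) (Fin 2) ℂ)) {M₂ : ℝ} (hM₂ : 0 ≤ M₂)
    (hrepr : ∀ (v : Matrix (Fin 2) (Fin 2) ℂ) (j : ι), |b.repr v j| ≤ M₂ * ‖v‖) (Rr : ℝ) (Hp : Prop) {a' : ℕ} (h8' : 8 ≤ (ℓ + 1) ^ a') :
    letI : CStarAlgebra (Matrix (Fin 2) (Fin 2) ℂ) := {}
    ∃ a₀' : ℝ, 0 < a₀' ∧ ∃ k₀ : ℕ, ∃ cα : ℝ, 0 < cα ∧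
    ∀ cL : ℝ, 0 < cL → cL * (((ℓ + 1 : ℕ) : ℝ)) ^ 2 < a₀' →
      cL ≤ min (1 / 16) (min aT (min aT (1 / (2 * (2 * B₀) * (14 * ((2 + 1 - 1 : ℕ) : ℝ)) * M + 1)))) → cL ≤ cα →
    ∃ B₁ B₂ c₁ : ℝ, 0 < B₁ ∧ 0 < B₂ ∧ 0 < c₁ ∧
    ∀ F : T3Family, F.L = ℓ + 1 → ∀ (n K : ℕ), n < K →
      (∀ (i : KIdx 2 ℓ hd₃ hL 1 1) (m' : ℕ), 1 ≤ m' → m' ≤ K - n → i.k = m' + 1 → (∀ x, i.D.lev x = m') → i.Mh = (ℓ + 1) ^ a' →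
        i.cf = (((ℓ + 1 : ℕ) : ℝ)) ^ (m' + 1) →
        (∀ ι : IBondY i, i.w ι = i.cf ^ 2 * (((((ℓ + 1 : ℕ) : ℝ)) ^ (ι.1.1 : ℕ)) ^ (2 + 1) * (1 / (((ℓ + 1 : ℕ) : ℝ)) ^ (ι.1.1 : ℕ)) ^ 2)) →
        (PV 2 ℓ i.m i.K hd₃ hL).sitesPerDir 0 = (PV 2 ℓ (F.m + k₀) K hd₃ hL).sitesPerDir 0 →
        ∀ (α₀ : ℝ) (U₀ : LSite (2 + 1) → Fin (2 + 1) → (Matrix (Fin 2) (Fin 2) ℂ)ˣ),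
        (∀ x κ, U₀ x κ ∈ B7Prop2Explicit.unitaryUnits (Matrix (Fin 2) (Fin 2) ℂ)) →
        IsPeriodic ((PV 2 ℓ (F.m + k₀) K hd₃ hL).sitesPerDir 0) U₀ → 0 < α₀ → α₀ ≤ aT →
        InAk (ℓ + 1) m' (eta F n K) α₀ (fun _ => (Set.univ : Set (LSite (2 + 1)))) U₀ →
          IsUnit (deltaAY i (parKnitY i) (parBY i) (GpY i (parKnitY i)) (bgY i U₀)) ∧
          (∀ F', wNormBY i (-1) (GAY i (parKnitY i) (parBY i) (GpY i (parKnitY i)) (bgY i U₀) F') ≤ B₀ * wNormBY i (-3) F') ∧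
          (∀ F' ν, wNormBY i (-2) (cdB i (bgY i U₀) ν (GAY i (parKnitY i) (parBY i) (GpY i (parKnitY i)) (bgY i U₀) F')) ≤ B₀ * wNormBY i (-3) F') ∧
          (∀ F', wNormBY i (-3) (lapB i (bgY i U₀) (GAY i (parKnitY i) (parBY i) (GpY i (parKnitY i)) (bgY i U₀) F')) ≤ B₀ * wNormBY i (-3) F')) →
      (((F.P K).sitesPerDir 0 : ℕ) : ℤ) ∣ (((PV 2 ℓ (F.m + k₀) K hd₃ hL).sitesPerDir 0 : ℕ) : ℤ) ∧
      (((ℓ + 1 : ℕ) : ℤ)) ^ (K - n) ∣ (((F.P K).sitesPerDir 0 : ℕ) : ℤ) ∧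
      Thm2TorusAt (ℓ + 1) (K - n) ((((PV 2 ℓ (F.m + k₀) K hd₃ hL).sitesPerDir 0 : ℕ) : ℤ)) (eta F n K) 0 B₁ B₂ c₁ len
        (specialUnitaryUnits (Fin 2)) (fun _ => True) := by
  letI : CStarAlgebra (Matrix (Fin 2) (Fin 2) ℂ) := {}
  obtain ⟨a₀', ha₀', k₀, cα, hcα, H⟩ :=
    thm2TorusAtSU_ofProp6_deltaAFour_exists (d := 2) (hd := hd₃) (hL := hL) (len := len) (by norm_num) (by norm_num) hℓ τ hτ hτt hCτ hM1 hB₀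
      haT haTQ haT3 haT2 hεB b hM₂ hrepr Rr Hp h8'
  refine ⟨a₀', ha₀', k₀, cα, hcα, fun cL hcL hαe hcLP hcLα => ?_⟩
  obtain ⟨B₁, B₂, c₁, hB₁, hB₂, hc₁, HT⟩ := H cL hcL hαe hcLP hcLα
  refine ⟨B₁, B₂, c₁, hB₁, hB₂, hc₁, fun F hF n K hnK hΔ => ⟨?_, ?_, ?_⟩⟩
  · -- the member's period divides the cover's: `2L^{F.m+K} ∣ 2L^{F.m+k₀+K}`
    rw [P_eq_PV (hd := hd₃) (hL := hL) F hF K]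
    show ((2 * (ℓ + 1) ^ (F.m + K - 0) : ℕ) : ℤ) ∣ ((2 * (ℓ + 1) ^ (F.m + k₀ + K - 0) : ℕ) : ℤ)
    rw [Nat.sub_zero, Nat.sub_zero]
    exact_mod_cast mul_dvd_mul_left 2 (pow_dvd_pow (ℓ + 1) (show F.m + K ≤ F.m + k₀ + K by omega))
  · -- `L^{K−n}` divides the member's period
    rw [P_eq_PV (hd := hd₃) (hL := hL) F hF K]
    exact pow_dvd_period (PV 2 ℓ F.m K hd₃ hL) (j := 0) (k := K - n) (show K - n ≤ F.m + K - 0 by omega)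
  · exact HT (F.m + k₀) K (K - n) (eta F n K) (by omega) (by omega) (eta_pos F n K) hΔ

end Literature.MathematicalPhysics.QuantumFieldTheory.Balaban1983to89.B8Thm2TorusCoverOfProp6DeltaAFour

end
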